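import Literature.Probability.Percolation.GladkovZiminKernel
import Literature.Probability.Percolation.GladkovThreeClusterDichotomyProofs
import HarnessLib

/-!
# The Gladkov–Zimin kernel inequality for bond percolation laws (`prodBernoulli`)

Topic `Literature/Probability/Percolation`.  Transfer of the finitary two-copy kernel inequality of
`GladkovZiminKernel.lean` (Gladkov–Zimin, *On Harris–Kleitman type inequalities*, draft 2024,
Thm. 2.3 [GladkovZimin2024HK]) to the bond-percolation measure `prodBernoulli w` on the
configurations `BondConfig V = Set (Sym2 V)` of a finite vertex type, via the law-of-all-pairs bridge
`prodBernoulli_real_eq_PrW_univ`.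

* `prodBernoulli_real_labelClass_eq_classMass` — the mass of a label class `{ω | lab ω = a}` is the
  finitary class mass of `GladkovZiminKernel.classMass` over `D = univ`;
* **`prodBernoulli_kernel_labelClass_le`** — for every labelling `lab` of configurations by a preorder
  that is monotone under adding open edges, every finite set `t` of labels containing all values, and
  every kernel `A` with `A a d + A b c ≤ A a c + A b d` for `a ≤ b`, `c ≤ d`:
  `Σ_{a,b ∈ t} A a b · μ(lab = a) μ(lab = b) ≤ Σ_{a ∈ t} A a a · μ(lab = a)`.

The case used by the percolation certificate searches of `Summits/CriticalPhenomena/PercolationContinuityZ3`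
(k-cluster line, KCLUSTER-gen6.md): `lab ω` = the partition of a set of marked terminals into open
clusters (monotone: more open edges, coarser partition), `A` a cover-supermodular kernel on the
partition lattice ("GZ rows").

## References

* N. Gladkov, A. Zimin, *On Harris–Kleitman type inequalities*, unpublished draft, September 2024,
  Thm. 2.3. [GladkovZimin2024HK]
-/

noncomputable section

namespace Literature.Probability.Percolation

open MeasureTheory Literature.Probability.LatticeModels DecisionTree
open scoped Classical

/-- The `prodBernoulli` mass of a label class is the finitary class mass over all pairs:
`μ{ω | lab ω = a} = classMass univ w (lab ∘ ↑) a`. [cite: GladkovZimin2024HK, Def. 1.3] -/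
theorem prodBernoulli_real_labelClass_eq_classMass {V : Type*} [Fintype V]
    (w : Sym2 V → unitInterval) {κ : Type*} (lab : BondConfig V → κ) (a : κ) :
    (prodBernoulli w).real {ω | lab ω = a} =
      classMass Finset.univ (fun e => (w e : ℝ)) (fun S : Finset (Sym2 V) => lab ↑S) a := by
  rw [prodBernoulli_real_eq_PrW_univ w (X := {S : Finset (Sym2 V) | lab ↑S = a}) (fun S => Iff.rfl)]
  unfold PrW classMass
  rw [Finset.sum_filter]
  refine Finset.sum_congr rfl fun S _ => ?_
  by_cases h : lab ↑S = a
  · rw [Set.indicator_of_mem (show S ∈ {S : Finset (Sym2 V) | lab ↑S = a} from h), if_pos h]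
  · rw [Set.indicator_of_notMem (show S ∉ {S : Finset (Sym2 V) | lab ↑S = a} from h), if_neg h]

/-- **Gladkov–Zimin, Theorem 2.3, for `prodBernoulli`.**  Let `lab` label bond configurations of a
finite vertex type by a preorder, monotonically under adding open edges (`ω ⊆ ω' → lab ω ≤ lab ω'`),
let `t` be a finite set of labels containing every value of `lab`, and let the kernel `A` satisfy
`A a d + A b c ≤ A a c + A b d` whenever `a ≤ b`, `c ≤ d`.  Then, with `μ = prodBernoulli w`,
`Σ_{a,b ∈ t} A a b · μ(lab = a) μ(lab = b) ≤ Σ_{a ∈ t} A a a · μ(lab = a)`.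
(Harris–Kleitman is the kernel `f₁ a · f₂ b` for increasing `f₁, f₂`; Gladkov's strong Harris–Kleitman
inequality and the Aas–Gladkov three-point row are the sunflower kernels.)
[cite: GladkovZimin2024HK, Thm. 2.3] -/
theorem prodBernoulli_kernel_labelClass_le {V : Type*} [Fintype V] (w : Sym2 V → unitInterval)
    {κ : Type*} [Preorder κ] (lab : BondConfig V → κ)
    (hlab : ∀ ⦃ω ω' : BondConfig V⦄, ω ⊆ ω' → lab ω ≤ lab ω') (t : Finset κ) (ht : ∀ ω, lab ω ∈ t)
    (A : κ → κ → ℝ) (hA : ∀ ⦃a b c d : κ⦄, a ≤ b → c ≤ d → A a d + A b c ≤ A a c + A b d) :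
    ∑ a ∈ t, ∑ b ∈ t, A a b *
        ((prodBernoulli w).real {ω | lab ω = a} * (prodBernoulli w).real {ω | lab ω = b}) ≤
      ∑ a ∈ t, A a a * (prodBernoulli w).real {ω | lab ω = a} := by
  simp only [prodBernoulli_real_labelClass_eq_classMass]
  refine kernel_classMass_le Finset.univ (fun e => (w e).2.1) (fun e => (w e).2.2)
    (fun S : Finset (Sym2 V) => lab ↑S) (fun S T hST => hlab (Finset.coe_subset.2 hST)) t
    (fun S _ => ht _) A hA

end Literature.Probability.Percolation

end
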